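import Summits.HodgeConjecture.HodgeConjecture.Theorems.Ring2AbelianAllTypeIIIFourfolds
import Summits.HodgeConjecture.HodgeConjecture.Theorems.Ring2AbelianAllQuaternionPolarization
import Summits.HodgeConjecture.HodgeConjecture.Theorems.Ring2AbelianAllQuaternionLagrangian
import Literature.AlgebraicGeometry.Motives.RationalDegreeOneModel
import Literature.AlgebraicGeometry.Motives.RationalDegreeOneModelWeilType
import HarnessLib

/-!
# Ring 2 · AbelianAll (seat `ab-weil-2`, gen 2) — LEMMA R1 IN THE KERNEL: an abelian fourfold with a definite quaternion
order acting compatibly with a hyperplane class carries a discriminant-1 Weil structure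

HONEST FRAMING (sub-cell `pub-hodge-ring2-ab-*`, verbatim): research route, not a corollary; conditional on HC_CM plus
one named minimal statement. (Cell `pub-hodge-ring2`, verbatim: research route conditional on HC_CM; not a corollary;
Q11.4-sentence-2 already refuted in dim ≥ 3.) THIS FILE uses neither `HC_CM` nor `B_min`; its main theorem uses NO named
fact at all (the only print input of the cohomology algebra, `H•(A(ℂ); ℂ) = ⋀• H¹`, is the tree's DISCHARGED fact
`Motives.abelianVarietyCohomologyExteriorH1_holds`). Third of three files (`…QuaternionPolarization`: Rosati closure on
`H²`; `…QuaternionLagrangian`: the isotropic stable frame over `ℚ`; this file: assembly on the carriers).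

WHAT CHANGES FOR THE CELL `Ring2.Atlas.HodgePowersOfTypeIIIFourfold` (atlas row g4.III(1), and the inherited g5 rows).
Gen 1 (`Theorems/Ring2AbelianAllTypeIIIFourfolds`, p195444/…/p199612) closed the cell modulo Floccari–Fu 2026 Thm. 1.2
(refereed named fact, binder `h5`) and the typed HYPOTHESIS `QuaternionFourfoldDichotomy`, whose branch (ii) was LEMMA R1
— "every simple type III(1) fourfold carries a `k ⊂ D` making `(X, k)` of Weil type with DISCRIMINANT 1" — a statement
DERIVED by this seat (refereed SOUND ×2, certificate 399/399, but cell-derived mathematics, hence a hypothesis under the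
ABSOLUTE RULE). This file PROVES Lemma R1 on the carriers:

* `hasDiscOneWeilStructure_of_anticomm_of_compatible` (§2): **for every abelian fourfold `A`, anticommuting
  `φ, ψ : A ⟶ A` with `φ ≫ φ = -d`, `ψ ≫ ψ = -e` (`d, e ≥ 1`) and a hyperplane class `L = ι^*a` with `φ^*L = d·L`,
  `ψ^*L = e·L`, the predicate `HasDiscOneWeilStructure A` HOLDS** — witnessed by an integral pure element
  `θ = a·φ + b·ψ + c·φψ` (`θ ≫ θ = -m`) and a `θ^*`-stable rational Lagrangian 4-frame of `H¹(A(ℂ); ℂ)` for the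
  `ℚ(θ)`-symmetrised class `m·L + θ^*L = 2m·L`. Proof: rational degree-one model `(u, P, ω, G)` of `(A, φ, L)` (tree:
  `Motives.exists_rationalModel_one`), the matrix `R` of `ψ^*` in the same frame, the identities `P² = -d`, `R² = -e`,
  `PR = -RP` (functoriality/additivity on `H¹`), `G` alternating and `PᵀGP = dG`, `RᵀGR = eG` (tree:
  `Motives.gram_antisymm`, `Motives.gram_map_eq_mul_gram`, fed by `φ^*L = dL`, `ψ^*L = eL`), then
  `exists_isotropic_stable_coords` (file 2) and `Motives.isHyperbolicWeilType_of_rationalModel`, and finally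
  `θ^*L = m·L` (file 1, `symmetrised_pure_eq_smul`) with `Motives.isHyperbolicWeilType_smul_iff`.
* Hence (§3) the gen-1 hypothesis shrinks to PRINT TRANSCRIPTION ONLY: `QuaternionFourfoldAlbertInput` — every member of
  the cell either has divisor-generated powers (type II: Moonen–Zarhin 1999 Thm. 0.1 (4), refereed) or
  `HasCompatibleQuaternionPair A` (type III(1): `End⁰ = D` definite quaternion — Albert/Shimura classification — and the
  Rosati involution of ANY polarization is the canonical involution of `D`, Mumford §21 Thm. 2 / Birkenhake–Lange
  Thm. 5.5.6, so `u^*L = nrd(u)·L` for `u ∈ D ∩ End A`; pick anticommuting pure `φ, ψ` in the order). KERNEL: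
  `quaternionFourfoldDichotomy_of_albertInput : QuaternionFourfoldAlbertInput → QuaternionFourfoldDichotomy` and
  **`hodgePowersOfTypeIIIFourfold_of_floccariFu_of_albertInput (h5) (hAlb) : Ring2.Atlas.HodgePowersOfTypeIIIFourfold`**;
  per variety, with no cell binders: `hodgeConjectureFor_powSucc_of_floccariFu_of_hasCompatibleQuaternionPair`.
  Atlas wording for g4.III(1) (+ g5.inh.E×III(1), g5.inh.E_k×III(1)): "KNOWN for every `(D, T)`: Floccari–Fu 2026
  Thm. 1.2 (refereed) + Lemma R1 (NOW A TREE THEOREM); residual hypothesis = print transcription (Albert + MZ99 0.1(4) +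
  Rosati type III)"; `HC_CM` ABSENT. Still NOT "closed outright": `h5` is a named fact and `hAlb` a typed print input.

## References

* [FloccariFu2026] S. Floccari, L. Fu, J. Math. Pures Appl. 210 (2026) 103876, Thm. 1.2 (tree fact, binder `h5`).
* [MumfordAV1970] D. Mumford, Abelian Varieties (1970), §20 (Rosati), §21 Thm. 2 (Albert; type III: standard involution).
* [LangeBirkenhake1992] H. Lange, Ch. Birkenhake, Complex Abelian Varieties (1992), Lemma 1.1.17, Prop. 1.1.9, §5.5
  (Thm. 5.5.3, 5.5.6), Thm. 9.9.1 (Shimura's exceptions).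
* [MoonenZarhin1999LowDim] B. Moonen, Yu. Zarhin, Math. Ann. 315 (1999), Thm. 0.1 (2) (c), (4).
* [vanGeemen1994HodgeAV] B. van Geemen, LNM 1594 (1994), 4.8–4.9, Lemma 5.2, 5.3–5.4, (5.4.1).
* [vanGeemenVerra2003QuaternionicPryms] B. van Geemen, A. Verra, Topology 42 (2003), §1.1, Lemma 4.5, Cor. 4.9.
* [Shimura1963AnalyticFamilies] G. Shimura, Ann. of Math. 78 (1963), Thm. 5. [HulekLaface2019PicardNumbers] Prop. 5.1.
-/

set_option linter.dupNamespace false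

noncomputable section

open CategoryTheory
open Literature.AlgebraicTopology.SingularHomology
open Literature.AlgebraicGeometry Literature.AlgebraicGeometry.HodgeTheory
open Literature.AlgebraicGeometry.Motives

namespace Summit.HodgeConjecture.HodgeConjecture.Ring2.AbelianAll

open Literature.Geometry.Kaehler

variable {A : AbelianVariety ℂ} {r : ℕ}

/-! ## §1 Frame bookkeeping: rational matrices of endomorphisms in a rational frame of `H¹` -/

/-- Coefficient comparison in a `ℂ`-independent frame: two rational matrices with the same columns of combinations are
equal. [folklore] -/
theorem matrix_eq_of_forall_sum_eq {u : Fin r → complexBetti A.X 1} (hu : LinearIndependent ℂ u)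
    {X Y : Matrix (Fin r) (Fin r) ℚ}
    (h : ∀ i, ∑ k, ((X k i : ℚ) : ℂ) • u k = ∑ k, ((Y k i : ℚ) : ℂ) • u k) : X = Y := by
  ext k i
  have h1 : ∑ j, (((X j i - Y j i : ℚ)) : ℂ) • u j = 0 := by
    simp only [Rat.cast_sub, sub_smul, Finset.sum_sub_distrib, h i, sub_self]
  have h2 := Fintype.linearIndependent_iff.1 hu (fun j => ((X j i - Y j i : ℚ) : ℂ)) h1 k
  have h3 : (X k i - Y k i : ℚ) = 0 := by exact_mod_cast h2
  exact sub_eq_zero.1 h3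

/-- Composition in a frame: if `f uᵢ = Σ_k P k i • u_k` and `g uᵢ = Σ_k R k i • u_k` then
`f (g uᵢ) = Σ_k (P R) k i • u_k`. [folklore] -/
theorem map_map_frame (f g : complexBetti A.X 1 →ₗ[ℂ] complexBetti A.X 1) (u : Fin r → complexBetti A.X 1)
    (P R : Matrix (Fin r) (Fin r) ℚ) (hP : ∀ i, f (u i) = ∑ k, ((P k i : ℚ) : ℂ) • u k)
    (hR : ∀ i, g (u i) = ∑ k, ((R k i : ℚ) : ℂ) • u k) (i : Fin r) :
    f (g (u i)) = ∑ k, (((P * R) k i : ℚ) : ℂ) • u k := by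
  rw [hR i, map_sum]
  simp_rw [map_smul, hP]
  rw [Motives.sum_smul_sum_smul_eq]
  refine Finset.sum_congr rfl fun k _ => ?_
  rw [Matrix.mul_apply]
  push_cast
  simp_rw [mul_comm (((R _ i : ℚ)) : ℂ)]

/-- `Σ_k (-(c • 1)) k i • u_k = -(c • uᵢ)`. [folklore] -/
theorem sum_neg_smul_one_apply_smul (c : ℚ) (u : Fin r → complexBetti A.X 1) (i : Fin r) :
    ∑ k, (((-(c • (1 : Matrix (Fin r) (Fin r) ℚ))) k i : ℚ) : ℂ) • u k = -((c : ℂ) • u i) := by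
  simp only [Matrix.neg_apply, Matrix.smul_apply, Matrix.one_apply, smul_eq_mul, mul_ite, mul_one, mul_zero]
  rw [Finset.sum_eq_single i]
  · simp
  · intro k _ hk; simp [hk]
  · intro hi; exact (hi (Finset.mem_univ i)).elim

/-- `Σ_k (-X) k i • u_k = -(Σ_k X k i • u_k)`. [folklore] -/
theorem sum_neg_apply_smul (X : Matrix (Fin r) (Fin r) ℚ) (u : Fin r → complexBetti A.X 1) (i : Fin r) :
    ∑ k, (((-X) k i : ℚ) : ℂ) • u k = -(∑ k, ((X k i : ℚ) : ℂ) • u k) := by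
  simp only [Matrix.neg_apply, Rat.cast_neg, neg_smul, Finset.sum_neg_distrib]

/-- The reduced norm `m = a²d + b²e + c²de` of a non-zero integral pure quaternion is positive (`d, e ≥ 1`).
[folklore] -/
theorem pos_of_pure_norm {a b c : ℤ} {d e : ℕ} (hd : 0 < d) (he : 0 < e) (habc : a ≠ 0 ∨ b ≠ 0 ∨ c ≠ 0) {m : ℕ}
    (hm : (m : ℤ) = a ^ 2 * d + b ^ 2 * e + c ^ 2 * (d * e)) : 0 < m := by
  have hd' : (0 : ℤ) < d := by exact_mod_cast hd
  have he' : (0 : ℤ) < e := by exact_mod_cast he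
  have hde : (0 : ℤ) < d * e := mul_pos hd' he'
  have ha2 := mul_nonneg (sq_nonneg a) hd'.le
  have hb2 := mul_nonneg (sq_nonneg b) he'.le
  have hc2 := mul_nonneg (sq_nonneg c) hde.le
  have hmz : (0 : ℤ) < m := by
    rw [hm]
    rcases habc with h0 | h0 | h0
    · have : (0 : ℤ) < a ^ 2 := by positivity
      nlinarith [mul_pos this hd']
    · have : (0 : ℤ) < b ^ 2 := by positivity
      nlinarith [mul_pos this he']
    · have : (0 : ℤ) < c ^ 2 := by positivity
      nlinarith [mul_pos this hde]
  exact_mod_cast hmz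

/-! ## §2 Lemma R1 in the kernel -/

/-- **LEMMA R1 (KERNEL).** Let `A` be an abelian FOURFOLD, `φ, ψ : A ⟶ A` with `φ ≫ φ = -(d • 𝟙)`, `ψ ≫ ψ = -(e • 𝟙)`
(`d, e ≥ 1`), `φ ≫ ψ = -(ψ ≫ φ)` — a definite quaternion order `ℤ⟨φ, ψ⟩ ⊂ End A` — and let `L = ι^*a` be a rational
hyperplane class with `φ^*L = d·L`, `ψ^*L = e·L` (the Rosati involution of `L` is quaternion conjugation on `φ, ψ`;
automatic when `A` is simple of type III, Mumford §21 Thm. 2). Then `A` carries a discriminant-1 Weil structure: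
`HasDiscOneWeilStructure A` — some integral pure `θ = a·φ + b·ψ + c·φψ`, `θ ≫ θ = -m`, `m ≥ 1`, and a `θ^*`-stable
rational Lagrangian 4-frame of `H¹(A(ℂ); ℂ)` for the `ℚ(θ)`-symmetrised class `m·ι^*a + θ^*ι^*a`. (Lemma R1 of seat
`ab-weil-2`; gen 1 stated it as branch (ii) of the hypothesis `QuaternionFourfoldDichotomy`.)
[cite: vanGeemen1994HodgeAV, Lemma 5.2 (2)–(3) and 5.4 (5.4.1)] [cite: MumfordAV1970, §21 Thm. 2]
[cite: vanGeemenVerra2003QuaternionicPryms, Lemma 4.5] -/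
theorem hasDiscOneWeilStructure_of_anticomm_of_compatible (hA : A.dim = 4) {φ ψ : A ⟶ A} {d e : ℕ}
    (hd : 0 < d) (he : 0 < e) (hφ : φ ≫ φ = -(d • 𝟙 A)) (hψ : ψ ≫ ψ = -(e • 𝟙 A)) (h : φ ≫ ψ = -(ψ ≫ φ))
    (ι : ProjectiveEmbedding A.X) (a : complexBetti (projectiveSpace ι.n ℂ) 2) (ha : IsRationalClass a)
    (ha0 : a ≠ 0)
    (hφL : complexBetti.map φ.hom.hom.hom 2 (complexBetti.map ι.ι 2 a) = (d : ℂ) • complexBetti.map ι.ι 2 a)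
    (hψL : complexBetti.map ψ.hom.hom.hom 2 (complexBetti.map ι.ι 2 a) = (e : ℂ) • complexBetti.map ι.ι 2 a) :
    HasDiscOneWeilStructure A := by
  classical
  set L := complexBetti.map ι.ι 2 a with hL
  have hLrat : IsRationalClass L := ha.map _
  have hA' : A.dim = 3 + 1 := by rw [hA]
  have hrank := Motives.AbelianVariety.finrank_complexBetti_one A
  have hspan := abelianVarietyCohomologyExteriorH1.span_range_cupPowOne abelianVarietyCohomologyExteriorH1_holds A
    (2 + 2 * 3)
  -- (1) rational degree-one model of `(A, φ, L)`
  obtain ⟨r, u, P, ω, G, -, hu, hind, husp, hP, -, hω0, hG, -⟩ := Motives.exists_rationalModel_one φ hA' L hLrat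
  let Bu : Module.Basis (Fin r) ℂ (complexBetti A.X 1) := Module.Basis.mk hind (by rw [husp])
  have hBu : ∀ i, Bu i = u i := fun i => Module.Basis.mk_apply hind _ i
  have hr : 4 < r := by
    have h1 := Module.finrank_eq_card_basis Bu
    rw [hrank, hA, Fintype.card_fin] at h1
    omega
  -- (2) the rational matrix `R` of `ψ^*` in the frame `u`
  have hBurat : ∀ i, IsRationalClass (Bu i) := fun i => by rw [hBu]; exact hu i
  have hψu : ∀ i, IsRationalClass (complexBetti.map ψ.hom.hom.hom 1 (u i)) := fun i => (hu i).map _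
  choose Rm hRm using fun k i => repr_mem_range_ratCast_of_isRationalClass Bu hBurat (hψu i) k
  obtain ⟨R, hRdef⟩ : ∃ R : Matrix (Fin r) (Fin r) ℚ, ∀ k i, R k i = Rm k i := ⟨Matrix.of Rm, fun k i => rfl⟩
  have hR : ∀ i, complexBetti.map ψ.hom.hom.hom 1 (u i) = ∑ k, ((R k i : ℚ) : ℂ) • u k := by
    intro i
    conv_lhs => rw [← Bu.sum_repr (complexBetti.map ψ.hom.hom.hom 1 (u i))]
    refine Finset.sum_congr rfl fun k _ => ?_
    rw [hRdef, hRm k i, hBu]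
  -- (3) matrix identities `P² = -d`, `R² = -e`, `PR = -RP`
  have hPP : P * P = -((d : ℚ) • (1 : Matrix (Fin r) (Fin r) ℚ)) := by
    refine matrix_eq_of_forall_sum_eq hind fun i => ?_
    rw [← map_map_frame (pbOne φ) (pbOne φ) u P P hP hP i, sum_neg_smul_one_apply_smul]
    exact complexBetti_map_map_one_of_comp_self hφ (u i)
  have hRR : R * R = -((e : ℚ) • (1 : Matrix (Fin r) (Fin r) ℚ)) := by
    refine matrix_eq_of_forall_sum_eq hind fun i => ?_
    rw [← map_map_frame (pbOne ψ) (pbOne ψ) u R R hR hR i, sum_neg_smul_one_apply_smul]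
    exact complexBetti_map_map_one_of_comp_self hψ (u i)
  have hPR : P * R = -(R * P) := by
    refine matrix_eq_of_forall_sum_eq hind fun i => ?_
    rw [← map_map_frame (pbOne φ) (pbOne ψ) u P R hP hR i, sum_neg_apply_smul,
      ← map_map_frame (pbOne ψ) (pbOne φ) u R P hR hP i]
    exact complexBetti_map_map_one_of_anticomm h (u i)
  -- (4) the Gram matrix: alternating and of Weil type for `P` and `R`
  have hGalt : ∀ i k, G i k = -G k i := fun i k => Motives.gram_antisymm L 3 u hω0 G hG i k
  have hPG : ∀ i k, ∑ a, ∑ b, P a i * G a b * P b k = (d : ℚ) * G i k :=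
    Motives.gram_map_eq_mul_gram hA' hrank hspan hd hφ hφL u P hP hω0 G hG
  have hRG : ∀ i k, ∑ a, ∑ b, R a i * G a b * R b k = (e : ℚ) * G i k :=
    Motives.gram_map_eq_mul_gram hA' hrank hspan he hψ hψL u R hR hω0 G hG
  -- (5) the isotropic stable frame (file 2)
  obtain ⟨a', b', c', habc, w, hw, hws, hwG⟩ := exists_isotropic_stable_coords hr P R G
    (Nat.cast_pos.2 hd) (Nat.cast_pos.2 he) hPP hRR hPR hGalt hPG hRG
  -- (6) the pure element `θ` and its norm `m`
  set θ : A ⟶ A := a' • φ + b' • ψ + c' • (φ ≫ ψ) with hθ_def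
  have hex : ∃ m : ℕ, (m : ℤ) = a' ^ 2 * d + b' ^ 2 * e + c' ^ 2 * (d * e) :=
    ⟨(a' ^ 2 * d + b' ^ 2 * e + c' ^ 2 * (d * e)).toNat, Int.toNat_of_nonneg (by positivity)⟩
  obtain ⟨m, hm⟩ := hex
  have hm0 : 0 < m := pos_of_pure_norm hd he habc hm
  have hθθ : θ ≫ θ = -(m • 𝟙 A) := pure_comp_pure_eq hφ hψ h a' b' c' hm
  -- (7) the matrix of `θ^*` in the frame is `a'P + b'R + c'PR`
  have hθu : ∀ i, complexBetti.map θ.hom.hom.hom 1 (u i) =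
      ∑ k, ((((a' : ℚ) • P + (b' : ℚ) • R + (c' : ℚ) • (P * R)) k i : ℚ) : ℂ) • u k := by
    intro i
    have h1 : pbOne θ = (a' : ℂ) • pbOne φ + (b' : ℂ) • pbOne ψ + (c' : ℂ) • (pbOne φ ∘ₗ pbOne ψ) := by
      rw [hθ_def, pbOne_add, pbOne_add, pbOne_zsmul, pbOne_zsmul, pbOne_zsmul, pbOne_comp]
    have h2 := congrArg (fun f => f (u i)) h1
    simp only [LinearMap.add_apply, LinearMap.smul_apply, LinearMap.comp_apply] at h2
    change complexBetti.map θ.hom.hom.hom 1 (u i) = _ at h2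
    rw [h2, map_map_frame (pbOne φ) (pbOne ψ) u P R hP hR i]
    change (a' : ℂ) • complexBetti.map φ.hom.hom.hom 1 (u i) + (b' : ℂ) • complexBetti.map ψ.hom.hom.hom 1 (u i) + _ = _
    rw [hP i, hR i]
    simp only [Finset.smul_sum, smul_smul, ← Finset.sum_add_distrib, ← add_smul]
    refine Finset.sum_congr rfl fun k _ => ?_
    congr 1
    simp only [Matrix.add_apply, Matrix.smul_apply, smul_eq_mul]
    push_cast
    ring
  -- (8) hyperbolic for `L`, then for the symmetrised class `m·L + θ^*L = 2m·L`
  have hypL : IsHyperbolicWeilType A θ 2 L :=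
    Motives.isHyperbolicWeilType_of_rationalModel u hu hind _ hθu G ω hG w hw hws hwG
  have hsym := symmetrised_pure_eq_smul hd he hφ hψ h hφL hψL a' b' c' hm
  refine ⟨θ, m, ι, a, hm0, hθθ, ha, ha0, ?_⟩
  rw [hsym]
  exact (Motives.isHyperbolicWeilType_smul_iff (mul_ne_zero two_ne_zero (Nat.cast_ne_zero.2 hm0.ne'))).2 hypL

/-! ## §3 The cell: the residual hypothesis is print transcription -/

/-- **`A` carries a compatible definite quaternion pair** (per-variety predicate; nothing asserted): anticommuting
`φ, ψ : A ⟶ A` with `φ ≫ φ = -d`, `ψ ≫ ψ = -e` (`d, e ≥ 1`) and a rational hyperplane class `ι^*a ≠ 0` on which both act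
by their norms, `φ^*ι^*a = d·ι^*a`, `ψ^*ι^*a = e·ι^*a`. For `A` SIMPLE of Albert TYPE III(1) (`End⁰ A = D` a definite
quaternion algebra over `ℚ`) this HOLDS for every projective embedding: the Rosati involution of every polarization is
the canonical involution of `D` (Mumford §21 Thm. 2; Birkenhake–Lange Thm. 5.5.6), i.e. `E(ux, uy) = nrd(u)E(x, y)`,
i.e. `u^* c₁ = nrd(u)·c₁` on `H²`, and any two anticommuting pure elements of the order `D ∩ End A` serve as `φ, ψ`.
[cite: MumfordAV1970, §21 Thm. 2] [cite: LangeBirkenhake1992, Thm. 5.5.6] -/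
def HasCompatibleQuaternionPair (A : AbelianVariety ℂ) : Prop :=
  ∃ (φ ψ : A ⟶ A) (d e : ℕ) (ι : ProjectiveEmbedding A.X) (a : complexBetti (projectiveSpace ι.n ℂ) 2),
    0 < d ∧ 0 < e ∧ φ ≫ φ = -(d • 𝟙 A) ∧ ψ ≫ ψ = -(e • 𝟙 A) ∧ φ ≫ ψ = -(ψ ≫ φ) ∧ IsRationalClass a ∧ a ≠ 0 ∧
      complexBetti.map φ.hom.hom.hom 2 (complexBetti.map ι.ι 2 a) = (d : ℂ) • complexBetti.map ι.ι 2 a ∧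
      complexBetti.map ψ.hom.hom.hom 2 (complexBetti.map ι.ι 2 a) = (e : ℂ) • complexBetti.map ι.ι 2 a

/-- **Lemma R1, predicate form**: a fourfold with a compatible definite quaternion pair carries a discriminant-1 Weil
structure. [cite: vanGeemen1994HodgeAV, Lemma 5.2 and 5.4] [cite: MumfordAV1970, §21 Thm. 2] -/
theorem hasDiscOneWeilStructure_of_hasCompatibleQuaternionPair (hA : A.dim = 4)
    (hQ : HasCompatibleQuaternionPair A) : HasDiscOneWeilStructure A := by
  obtain ⟨φ, ψ, d, e, ι, a, hd, he, hφ, hψ, h, ha, ha0, hφL, hψL⟩ := hQ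
  exact hasDiscOneWeilStructure_of_anticomm_of_compatible hA hd he hφ hψ h ι a ha ha0 hφL hψL

/-- **HC for ALL POWERS of every abelian fourfold with a compatible definite quaternion pair** — in particular of every
simple abelian fourfold of type III(1), every `(D, T)` — from Floccari–Fu 2026 Thm. 1.2 ALONE (binder `h5`): Lemma R1 is
now supplied by the kernel. `HC_CM` absent; Markman 2025 and Abdulali's domination theorems not used.
[cite: FloccariFu2026, Theorem 1.2] [cite: MumfordAV1970, §21 Thm. 2] -/
theorem hodgeConjectureFor_powSucc_of_floccariFu_of_hasCompatibleQuaternionPair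
    (h5 : FloccariFu2026_hodgeClasses_algebraic_powers_discOneWeilFourfold) (hA : A.dim = 4)
    (hQ : HasCompatibleQuaternionPair A) (N : ℕ) : HodgeConjectureFor (A.powSucc N).dim (A.powSucc N).X :=
  hodgeConjectureFor_powSucc_of_floccariFu_of_hasDiscOneWeilStructure h5 A hA
    (hasDiscOneWeilStructure_of_hasCompatibleQuaternionPair hA hQ) N

/-- **TYPED PRINT INPUT (hypothesis, never a fact): the Albert trichotomy of the cell, transcription only.** Every
member `(A, φ, d)` of `Ring2.Atlas.HodgePowersOfTypeIIIFourfold` (simple fourfold, non-commutative `End`, `φ ≫ φ = -d`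
with `(2,2)` Weil classes; so `End⁰ A` is a quaternion algebra over `ℚ` — Albert, with Shimura's exclusions, Shimura
1963 Thm. 5 / Birkenhake–Lange Thm. 9.9.1 / Hulek–Laface Prop. 5.1) EITHER has divisor-generated powers (types II:
Moonen–Zarhin 1999 Thm. 0.1 (4), "`B(Xⁿ) = D(Xⁿ)` for all `n`", refereed) OR `HasCompatibleQuaternionPair A` (type
III(1): Mumford §21 Thm. 2). Compared with gen 1's `QuaternionFourfoldDichotomy` the DERIVED content (Lemma R1) is
GONE — it is `hasDiscOneWeilStructure_of_hasCompatibleQuaternionPair`; what remains is print.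
[cite: MoonenZarhin1999LowDim, Thm. 0.1 (2) and (4)] [cite: MumfordAV1970, §21 Thm. 2]
[cite: Shimura1963AnalyticFamilies, Thm. 5] [cite: HulekLaface2019PicardNumbers, Prop. 5.1]
[status: typed print input; hypothesis in the kernel] -/
@[conjecture] def QuaternionFourfoldAlbertInput : Prop :=
  ∀ (A : AbelianVariety ℂ) (φ : A ⟶ A) (d : ℕ), 0 < d → A.dim = 4 → φ ≫ φ = -(d • 𝟙 A) →
    (∀ c ∈ weilClassesOf A φ 2 d, IsOfHodgeType 4 A.X 4 2 2 c) →
    A.IsSimple → (∃ ψ χ : A ⟶ A, ψ ≫ χ ≠ χ ≫ ψ) →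
    (∀ N : ℕ, IsDivisorGenerated (A.powSucc N)) ∨ HasCompatibleQuaternionPair A

/-- **The print input implies gen 1's dichotomy** (Lemma R1 discharged by the kernel): the cell's residual hypothesis
got WEAKER, not different. [cite: MoonenZarhin1999LowDim, Thm. 0.1 (4)] [cite: MumfordAV1970, §21 Thm. 2] -/
theorem quaternionFourfoldDichotomy_of_albertInput (hAlb : QuaternionFourfoldAlbertInput) :
    QuaternionFourfoldDichotomy := by
  intro A φ d hd hA hφ hW hs hnc
  rcases hAlb A φ d hd hA hφ hW hs hnc with hD | hQ
  · exact Or.inl hD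
  · exact Or.inr (hasDiscOneWeilStructure_of_hasCompatibleQuaternionPair hA hQ)

/-- **CLOSING OF THE CELL, gen 2: Floccari–Fu (refereed fact `h5`) + print transcription (`hAlb`) ⟹
`Ring2.Atlas.HodgePowersOfTypeIIIFourfold`** — HC for all powers of every simple abelian fourfold with non-commutative
endomorphism ring and a `(2,2)` Weil structure; `HC_CM` ABSENT; no cell-derived hypothesis left.
[cite: FloccariFu2026, Theorem 1.2] [cite: MoonenZarhin1999LowDim, Thm. 0.1 (4)] [cite: MumfordAV1970, §21 Thm. 2] -/
theorem hodgePowersOfTypeIIIFourfold_of_floccariFu_of_albertInput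
    (h5 : FloccariFu2026_hodgeClasses_algebraic_powers_discOneWeilFourfold) (hAlb : QuaternionFourfoldAlbertInput) :
    Ring2.Atlas.HodgePowersOfTypeIIIFourfold :=
  hodgePowersOfTypeIIIFourfold_of_floccariFu_of_dichotomy h5 (quaternionFourfoldDichotomy_of_albertInput hAlb)

/-- The same through the atlas's discriminant-1 sub-cell instead of the named fact (whoever discharges
`Ring2.Atlas.HodgePowersOfDiscOneWeilFourfold` closes the type III cell, given the print input).
[cite: FloccariFu2026, Theorem 1.2] [cite: MoonenZarhin1999LowDim, Thm. 0.1 (4)] -/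
theorem hodgePowersOfTypeIIIFourfold_of_discOneWeilFourfold_of_albertInput
    (h : Ring2.Atlas.HodgePowersOfDiscOneWeilFourfold) (hAlb : QuaternionFourfoldAlbertInput) :
    Ring2.Atlas.HodgePowersOfTypeIIIFourfold :=
  hodgePowersOfTypeIIIFourfold_of_discOneWeilFourfold_of_dichotomy h (quaternionFourfoldDichotomy_of_albertInput hAlb)

end Summit.HodgeConjecture.HodgeConjecture.Ring2.AbelianAll

end
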